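import Summits.AtomisticToContinuum.BoseEinsteinCondensation.Theorems.BECSectorPoincareTwoScaleGPWindowSectorGap
import Summits.AtomisticToContinuum.BoseEinsteinCondensation.Theorems.BECConjugateDominationIMUChainGlueEnergy
import Literature.MathematicalPhysics.QuantumManyBody.BogoliubovSpectrumGP
import Literature.MathematicalPhysics.QuantumManyBody.BogoliubovSpectralGapGP
import Mathlib.Analysis.SpecialFunctions.Pow.Asymptotics
import HarnessLib

/-!
# `GPWindowSectorGap` (support item stmt-AtomisticToContinuum-9097 of route BECSectorPoincareTwoScale):
a Ky Fan gap gives the sector gap, and the Gross–Pitaevskii-ray case from BBCS 2019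

Companion of `BECSectorPoincareTwoScaleGPWindowSectorGap.lean` (the free kinetic floor). The item asks
for a uniform gap `θ/ℓ²` above `E₀^per(n,ℓ)` in every Bloch sector `k = (2π/ℓ)m ≠ 0`. Here:

* `gpw_setIntegral_sq_eq_zero` — for a Bloch state with `m ≠ 0`, `∫_cell Ψ² = 0` (`Ψ²` is Bloch with
  `2m ≠ 0`, hence has zero mean);
* `gpw_conj_orthogonal` — so `Ψ` and its complex conjugate `Ψ̄` (Bloch sector `-m ≠ m`, same energy,
  `periodicEnergy_conj`) are ORTHOGONAL in `L²(cell)`;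
* `gpw_kyFanTwo_le_two_mul` — therefore `kyFanTwo v n ℓ ≤ 2 · periodicEnergy v Ψ` (the Ky Fan pair
  `(Ψ, Ψ̄)`), with NO nondegeneracy / Perron–Frobenius input;
* `gpw_sectorGap_of_kyFanGap` — a Ky Fan gap `2E₀ + 2θ/ℓ² ≤ kyFanTwo` forces the item's conclusion
  `E₀ + θ/ℓ² ≤ periodicEnergy v Ψ` for every Bloch state with `m ≠ 0`;
* `gpWindowSectorGap_of_uniformKyFanGap` — hence the route decl `GPWindowSectorGap` follows from the
  same statement with the sector hypothesis replaced by the Ky Fan two-sum (a reduction, by name);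
* `gpw_gpRay_of_firstGap_GP` — and, CONDITIONALLY on the vendored named fact
  `BoccatoEtAl2019_firstGap_GP` (BBCS 2019 Acta Thm 1.1, first gap in Ky Fan form, `∫ v³ < ∞`), the item's
  conclusion holds with `θ = π²` along every Gross–Pitaevskii ray `ℓ = N ℓ₁`, `N ≥ N₀(v, ℓ₁)`.

What this isolates about the item as filed: print (BBCS) gives the gap per GP ray with ray-dependent
constants and thresholds, for `V ∈ L³`; the item wants one `θ, ℓ₀` for all `na/ℓ ∈ (0, M²]` and all
`n` (including bounded `n`, `ℓ → ∞`), and for every `IsRepulsiveFiniteRange v` (hard cores, where the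
Gross–Pitaevskii excitation spectrum is open). [folklore]
-/

noncomputable section

namespace Summit.AtomisticToContinuum.BoseEinsteinCondensation.Theorems

open MeasureTheory Filter
open scoped ENNReal NNReal ComplexConjugate Topology
open Literature.MathematicalPhysics.QuantumManyBody.BoseGas

variable {n : ℕ} {ℓ : ℝ}

/-- Doubling a dual-lattice momentum: `(2π/ℓ)m + (2π/ℓ)m = (2π/ℓ)(m + m)`. [folklore] -/
theorem gpw_latticeVec_add_self (c : ℝ) (m : Fin 3 → ℤ) :
    latticeVec c m + latticeVec c m = latticeVec c (m + m) := by
  ext t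
  simp only [latticeVec, PiLp.add_apply, PiLp.toLp_apply, Pi.add_apply, Int.cast_add]
  ring

/-- **A Bloch state with `m ≠ 0` is `L²(cell)`-orthogonal to its own conjugate: `∫_cell Ψ² = 0`.**
(`Ψ²` lies in the Bloch sector `2m ≠ 0` (`HasTotalMomentum.mul`), so its mean over the cell vanishes,
`gpw_configFourierCoeff_zero_eq_zero`.) [folklore] -/
theorem gpw_setIntegral_sq_eq_zero (hℓ : 0 < ℓ) {m : Fin 3 → ℤ} (hm : m ≠ 0)
    (Ψ : PeriodicTrialState n ℓ) (hB : HasTotalMomentum (latticeVec (2 * Real.pi / ℓ) m) Ψ.ψ) :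
    ∫ X in cellN n ℓ, Ψ.ψ X ^ 2 = 0 := by
  have hsq : HasTotalMomentum (latticeVec (2 * Real.pi / ℓ) (m + m)) fun X => Ψ.ψ X ^ 2 := by
    have h := hB.mul hB
    rw [gpw_latticeVec_add_self] at h
    simpa only [sq] using h
  have hcont : Continuous fun X => Ψ.ψ X ^ 2 := Ψ.contDiff.continuous.pow 2
  have hper : IsTorusPeriodic ℓ fun X => Ψ.ψ X ^ 2 := fun X i k => by
    simp only [Ψ.periodic X i k]
  -- `m + m ≠ 0` (cf. `InfraredMinimumUncertainty.Negative.add_self_ne_zero_of_ne`, not imported here)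
  have hmm : m + m ≠ 0 := by
    intro h
    apply hm
    funext t
    have ht := congrFun h t
    simp only [Pi.add_apply, Pi.zero_apply] at ht
    have : m t = 0 := by omega
    simpa using this
  have h0 := gpw_configFourierCoeff_zero_eq_zero hℓ hmm hcont hper
    ((gpw_hasTotalMomentum_iff ℓ (m + m) _).mpr hsq)
  rw [configFourierCoeff_zero hℓ hcont.aestronglyMeasurable, smul_eq_zero] at h0
  refine h0.resolve_left ?_
  exact pow_ne_zero _ (inv_ne_zero (pow_ne_zero _ hℓ.ne'))

/-- The Ky Fan orthogonality of the pair `(Ψ, Ψ̄)`: `∫_cell conj(Ψ) · Ψ̄ = conj(∫_cell Ψ²) = 0`.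
[folklore] -/
theorem gpw_conj_orthogonal (hℓ : 0 < ℓ) {m : Fin 3 → ℤ} (hm : m ≠ 0)
    (Ψ : PeriodicTrialState n ℓ) (hB : HasTotalMomentum (latticeVec (2 * Real.pi / ℓ) m) Ψ.ψ) :
    ∫ X in cellN n ℓ, conj (Ψ.ψ X) * Ψ.conj.ψ X = 0 := by
  have h : ∀ X, conj (Ψ.ψ X) * Ψ.conj.ψ X = conj (Ψ.ψ X ^ 2) := fun X => by
    rw [PeriodicTrialState.conj_apply, sq, map_mul]
  simp_rw [h]
  rw [integral_conj, gpw_setIntegral_sq_eq_zero hℓ hm Ψ hB, map_zero]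

/-- **`kyFanTwo ≤ 2⟨Ψ, HΨ⟩` on every non-zero Bloch sector.** For a Bloch state with `m ≠ 0` the pair
`(Ψ, Ψ̄)` is admissible in the Ky Fan two-sum (`gpw_conj_orthogonal`) and `⟨Ψ̄, HΨ̄⟩ = ⟨Ψ, HΨ⟩`
(`periodicEnergy_conj`). No nondegeneracy of the ground state is used. [folklore] -/
theorem gpw_kyFanTwo_le_two_mul (v : ℝ → ℝ≥0∞) (hℓ : 0 < ℓ) {m : Fin 3 → ℤ} (hm : m ≠ 0)
    (Ψ : PeriodicTrialState n ℓ) (hB : HasTotalMomentum (latticeVec (2 * Real.pi / ℓ) m) Ψ.ψ) :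
    kyFanTwo v n ℓ ≤ 2 * periodicEnergy v Ψ := by
  unfold kyFanTwo
  refine (iInf_le_of_le Ψ <| iInf_le_of_le Ψ.conj <| iInf_le _ (gpw_conj_orthogonal hℓ hm Ψ hB)).trans
    (le_of_eq ?_)
  rw [periodicEnergy_conj, two_mul]

/-- **A Ky Fan gap is a sector gap.** If `2E₀^per(n,ℓ) + 2θ/ℓ² ≤ kyFanTwo v n ℓ` then every Bloch
state with `m ≠ 0` (condition as inlined in the route items) has `E₀^per(n,ℓ) + θ/ℓ² ≤ periodicEnergy v Ψ`
— the conclusion of `GPWindowSectorGap`. [folklore] -/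
theorem gpw_sectorGap_of_kyFanGap (v : ℝ → ℝ≥0∞) (hℓ : 0 < ℓ) {m : Fin 3 → ℤ} (hm : m ≠ 0)
    (Ψ : PeriodicTrialState n ℓ)
    (hB : ∀ (X : Config n) (s : EuclideanSpace ℝ (Fin 3)),
        Ψ.ψ (fun j => X j + s) =
          Complex.exp (Complex.I * ↑(2 * Real.pi / ℓ * ∑ t : Fin 3, (m t : ℝ) * s t)) * Ψ.ψ X)
    {θ : ℝ}
    (hK : 2 * periodicGroundStateEnergy v n ℓ + ENNReal.ofReal (2 * θ / ℓ ^ 2) ≤ kyFanTwo v n ℓ) :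
    periodicGroundStateEnergy v n ℓ + ENNReal.ofReal (θ / ℓ ^ 2) ≤ periodicEnergy v Ψ := by
  have hB' := (gpw_hasTotalMomentum_iff ℓ m Ψ.ψ).mp hB
  have h2 : 2 * (periodicGroundStateEnergy v n ℓ + ENNReal.ofReal (θ / ℓ ^ 2)) ≤
      2 * periodicEnergy v Ψ := by
    refine le_trans (le_of_eq ?_) (hK.trans (gpw_kyFanTwo_le_two_mul v hℓ hm Ψ hB'))
    rw [mul_add, mul_div_assoc, ENNReal.ofReal_mul (by norm_num : (0 : ℝ) ≤ 2), ENNReal.ofReal_ofNat]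
  exact (ENNReal.mul_le_mul_iff_right two_ne_zero ENNReal.ofNat_ne_top).mp h2

/-- **Reduction of the route decl to a uniform Ky Fan gap.** `GPWindowSectorGap` follows from the same
statement with "every Bloch state with `m ≠ 0` lies `θ/ℓ²` above `E₀`" replaced by the Ky Fan form
"`2E₀ + 2θ/ℓ² ≤ kyFanTwo v n ℓ`" (the form in which Gross–Pitaevskii spectral gaps are printed and
vendored, e.g. `BoccatoEtAl2019_firstGap_GP`). [folklore] -/
theorem gpWindowSectorGap_of_uniformKyFanGap
    (H : ∀ v : ℝ → ℝ≥0∞, IsRepulsiveFiniteRange v → ∀ M : ℝ, 0 < M → ∃ θ : ℝ, 0 < θ ∧ ∃ ℓ₀ : ℝ,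
      ∀ ℓ : ℝ, ℓ₀ ≤ ℓ → 0 < ℓ → ∀ n : ℕ, (n : ℝ) * (scatteringLength v).toReal ≤ M ^ 2 * ℓ →
        2 * periodicGroundStateEnergy v n ℓ + ENNReal.ofReal (2 * θ / ℓ ^ 2) ≤ kyFanTwo v n ℓ) :
    Theses.BECSectorPoincareTwoScale.GPWindowSectorGap := by
  intro v hv M hM
  obtain ⟨θ, hθ, ℓ₀, hK⟩ := H v hv M hM
  refine ⟨θ, hθ, ℓ₀, fun ℓ hℓ₀ hℓ n hn m hm Ψ hB => ?_⟩
  exact gpw_sectorGap_of_kyFanGap v hℓ hm Ψ hB (hK ℓ hℓ₀ hℓ n hn)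

/-- The BBCS error `C N^{-1/4}` is eventually below `2π²`. [folklore] -/
theorem gpw_eventually_error_le (C : ℝ) :
    ∃ N₁ : ℕ, ∀ N : ℕ, N₁ ≤ N → C * (N : ℝ) ^ (-(1 : ℝ) / 4) ≤ 2 * Real.pi ^ 2 := by
  have h1 : Tendsto (fun N : ℕ => C * (N : ℝ) ^ (-(1 : ℝ) / 4)) atTop (𝓝 (C * 0)) := by
    have h := (tendsto_rpow_neg_atTop (by norm_num : (0 : ℝ) < 1 / 4)).comp tendsto_natCast_atTop_atTop
    have h' : Tendsto (fun N : ℕ => (N : ℝ) ^ (-(1 : ℝ) / 4)) atTop (𝓝 0) := by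
      refine h.congr fun N => ?_
      simp only [Function.comp_apply]
      norm_num
    exact h'.const_mul C
  rw [mul_zero] at h1
  have h2 : ∀ᶠ N : ℕ in atTop, C * (N : ℝ) ^ (-(1 : ℝ) / 4) ≤ 2 * Real.pi ^ 2 :=
    (h1.eventually (eventually_le_nhds (by positivity))).mono fun _ h => h
  exact eventually_atTop.mp h2

/-- `(2π)² ≤ ε = √((2π)⁴ + 16π(a/ℓ₁)(2π)²)` for `a, ℓ₁ ≥ 0`: the Bogoliubov dispersion at the lowest
momentum is at least the free one. [folklore] -/
theorem gpw_four_pi_sq_le_eps {a ℓ₁ : ℝ} (ha : 0 ≤ a) (hℓ₁ : 0 ≤ ℓ₁) :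
    4 * Real.pi ^ 2 ≤ Real.sqrt ((2 * Real.pi) ^ 4 + 16 * Real.pi * (a / ℓ₁) * (2 * Real.pi) ^ 2) := by
  rw [show (4 * Real.pi ^ 2 : ℝ) = Real.sqrt ((2 * Real.pi) ^ 4) by
    rw [show ((2 * Real.pi) ^ 4 : ℝ) = (4 * Real.pi ^ 2) ^ 2 by ring, Real.sqrt_sq (by positivity)]]
  gcongr
  have : 0 ≤ 16 * Real.pi * (a / ℓ₁) * (2 * Real.pi) ^ 2 := by positivity
  linarith

/-- **From the two printed BBCS inequalities to a Ky Fan gap `2π²/L²`.** If `4π² ≤ ε`, `c ≤ 2π²` and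
`2E + ε/L² ≤ K + c/L²` in `ℝ≥0∞` (the lower half of `|θ₂ - θ₁ - ε/L²| ≤ c/L²` written without
subtraction), then `2E + 2π²/L² ≤ K`. [folklore] -/
theorem gpw_kyFanGap_of_errorBound {E K : ℝ≥0∞} {ε c L : ℝ} (hL : 0 < L)
    (hε : 4 * Real.pi ^ 2 ≤ ε) (hc : c ≤ 2 * Real.pi ^ 2)
    (h2 : 2 * E + ENNReal.ofReal (ε / L ^ 2) ≤ K + ENNReal.ofReal (c / L ^ 2)) :
    2 * E + ENNReal.ofReal (2 * Real.pi ^ 2 / L ^ 2) ≤ K := by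
  have hL2 : 0 < L ^ 2 := by positivity
  have hsplit : ENNReal.ofReal (2 * Real.pi ^ 2 / L ^ 2) + ENNReal.ofReal (max c 0 / L ^ 2) ≤
      ENNReal.ofReal (ε / L ^ 2) := by
    rw [← ENNReal.ofReal_add (by positivity) (by positivity), ← add_div]
    refine ENNReal.ofReal_le_ofReal (div_le_div_of_nonneg_right ?_ hL2.le)
    have : max c 0 ≤ 2 * Real.pi ^ 2 := max_le hc (by positivity)
    linarith
  have hmono : K + ENNReal.ofReal (c / L ^ 2) ≤ K + ENNReal.ofReal (max c 0 / L ^ 2) := by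
    gcongr
    exact le_max_left _ _
  have hchain : 2 * E + ENNReal.ofReal (2 * Real.pi ^ 2 / L ^ 2) + ENNReal.ofReal (max c 0 / L ^ 2) ≤
      K + ENNReal.ofReal (max c 0 / L ^ 2) :=
    calc 2 * E + ENNReal.ofReal (2 * Real.pi ^ 2 / L ^ 2) + ENNReal.ofReal (max c 0 / L ^ 2)
        = 2 * E + (ENNReal.ofReal (2 * Real.pi ^ 2 / L ^ 2) + ENNReal.ofReal (max c 0 / L ^ 2)) :=
          add_assoc _ _ _
      _ ≤ 2 * E + ENNReal.ofReal (ε / L ^ 2) := by gcongr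
      _ ≤ K + ENNReal.ofReal (c / L ^ 2) := h2
      _ ≤ K + ENNReal.ofReal (max c 0 / L ^ 2) := hmono
  exact (ENNReal.add_le_add_iff_right ENNReal.ofReal_ne_top).mp hchain

/-- **The Gross–Pitaevskii-ray case of the item, conditionally on BBCS 2019 (Acta) Thm 1.1.** Assume the
vendored named fact `BoccatoEtAl2019_firstGap_GP` (first gap of the periodic `N`-body Hamiltonian in the
box of side `L = Nℓ₁`, Ky Fan form, for measurable radial `v ≥ 0` of finite range with `∫ v(|x|)³ < ∞`).
Then for every such `v` and every Gross–Pitaevskii unit `ℓ₁ > 0` there is `N₀` such that for all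
`N ≥ N₀`, in the box of side `ℓ = Nℓ₁`, EVERY Bloch state with `m ≠ 0` satisfies
`E₀^per(N, ℓ) + π²/ℓ² ≤ periodicEnergy v Ψ` (`ε ≥ 4π²` and `C N^{-1/4} ≤ 2π²` give the Ky Fan gap
`2π²/ℓ²`, then `gpw_sectorGap_of_kyFanGap`). This is `GPWindowSectorGap`'s conclusion restricted to ONE
ray `na/ℓ = a/ℓ₁` with a ray-dependent threshold — the part of the item that print supports.
[cite: BoccatoEtAl2019Acta, Thm 1.1] -/
theorem gpw_gpRay_of_firstGap_GP (hBBCS : BoccatoEtAl2019_firstGap_GP) (v : ℝ → ℝ≥0∞) (R₀ ℓ₁ : ℝ)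
    (hv : Measurable v) (hR : ∀ r, R₀ < r → v r = 0) (hv3 : (∫⁻ x : Space, v ‖x‖ ^ 3) ≠ ⊤)
    (hℓ₁ : 0 < ℓ₁) :
    ∃ N₀ : ℕ, ∀ N : ℕ, N₀ ≤ N → ∀ m : Fin 3 → ℤ, m ≠ 0 →
      ∀ Ψ : PeriodicTrialState N ((N : ℝ) * ℓ₁),
        (∀ (X : Config N) (s : EuclideanSpace ℝ (Fin 3)),
          Ψ.ψ (fun j => X j + s) =
            Complex.exp (Complex.I * ↑(2 * Real.pi / ((N : ℝ) * ℓ₁) * ∑ t : Fin 3, (m t : ℝ) * s t)) *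
              Ψ.ψ X) →
        periodicGroundStateEnergy v N ((N : ℝ) * ℓ₁) + ENNReal.ofReal (Real.pi ^ 2 / ((N : ℝ) * ℓ₁) ^ 2) ≤
          periodicEnergy v Ψ := by
  obtain ⟨C, N₀, hgap⟩ := hBBCS v R₀ ℓ₁ hv hR hv3 hℓ₁
  obtain ⟨N₁, hN₁⟩ := gpw_eventually_error_le C
  refine ⟨max (max N₀ N₁) 1, fun N hN m hm Ψ hB => ?_⟩
  have hN0 : N₀ ≤ N := le_trans (le_trans (le_max_left _ _) (le_max_left _ _)) hN
  have hN1 : N₁ ≤ N := le_trans (le_trans (le_max_right _ _) (le_max_left _ _)) hN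
  have hNpos : (0 : ℝ) < N := by exact_mod_cast lt_of_lt_of_le Nat.one_pos (le_trans (le_max_right _ _) hN)
  have hLpos : 0 < (N : ℝ) * ℓ₁ := mul_pos hNpos hℓ₁
  have h2 := (hgap N hN0).2
  have hεge : 4 * Real.pi ^ 2 ≤
      Real.sqrt ((2 * Real.pi) ^ 4 + 16 * Real.pi * ((scatteringLength v).toReal / ℓ₁) * (2 * Real.pi) ^ 2) :=
    gpw_four_pi_sq_le_eps ENNReal.toReal_nonneg hℓ₁.le
  have hcle : C * (N : ℝ) ^ (-(1 : ℝ) / 4) ≤ 2 * Real.pi ^ 2 := hN₁ N hN1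
  -- the Ky Fan two-sum of the fact is `kyFanTwo v N (Nℓ₁)` by definition
  change 2 * periodicGroundStateEnergy v N ((N : ℝ) * ℓ₁) +
      ENNReal.ofReal (Real.sqrt ((2 * Real.pi) ^ 4 +
        16 * Real.pi * ((scatteringLength v).toReal / ℓ₁) * (2 * Real.pi) ^ 2) / ((N : ℝ) * ℓ₁) ^ 2) ≤
    kyFanTwo v N ((N : ℝ) * ℓ₁) + ENNReal.ofReal (C * (N : ℝ) ^ (-(1 : ℝ) / 4) / ((N : ℝ) * ℓ₁) ^ 2) at h2
  have hK := gpw_kyFanGap_of_errorBound hLpos hεge hcle h2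
  exact gpw_sectorGap_of_kyFanGap v hLpos hm Ψ hB (θ := Real.pi ^ 2) hK

/-- **The mean-field window (unconditional, integrable potentials).** For measurable `v ≥ 0` with
`‖ṽ‖₁ = ∫_{ℝ³} v(|x|)dx < ∞`, `0 ≤ θ`, `ℓ > 0` and `n(n−1)‖ṽ‖₁ ≤ 2(4π² − θ)ℓ`, every Bloch state with `m ≠ 0`
satisfies the item's conclusion `E₀^per(n,ℓ) + θ/ℓ² ≤ periodicEnergy v Ψ`: the constant trial state gives
`E₀^per(n,ℓ) ≤ C(n,2)‖ṽ‖₁/ℓ³ ≤ (4π² − θ)/ℓ²` (`IMUChainGlue.periodicGroundStateEnergy_le_pairs`) and the free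
floor `(2π/ℓ)²` does the rest. This is the part of the `GPWindowSectorGap` window (`n ≲ √(ℓ/‖ṽ‖₁)` instead of
`n ≤ M²ℓ/a`) reachable without Bogoliubov theory. [folklore] -/
theorem gpw_of_meanField_window (v : ℝ → ℝ≥0∞) (hv : Measurable v) (hI : (∫⁻ x : Space, v ‖x‖) ≠ ⊤)
    (hℓ : 0 < ℓ) {θ : ℝ} (hθ : 0 ≤ θ)
    (hwin : (n : ℝ) * ((n : ℝ) - 1) * (∫⁻ x : Space, v ‖x‖).toReal ≤ 2 * (4 * Real.pi ^ 2 - θ) * ℓ)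
    {m : Fin 3 → ℤ} (hm : m ≠ 0) (Ψ : PeriodicTrialState n ℓ)
    (hB : ∀ (X : Config n) (s : EuclideanSpace ℝ (Fin 3)),
        Ψ.ψ (fun j => X j + s) =
          Complex.exp (Complex.I * ↑(2 * Real.pi / ℓ * ∑ t : Fin 3, (m t : ℝ) * s t)) * Ψ.ψ X) :
    periodicGroundStateEnergy v n ℓ + ENNReal.ofReal (θ / ℓ ^ 2) ≤ periodicEnergy v Ψ := by
  rcases Nat.lt_or_ge n 2 with hn | hn
  · -- `n ≤ 1`: the window only says `θ ≤ 4π²`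
    have h0 : (n : ℝ) * ((n : ℝ) - 1) = 0 := by
      interval_cases n <;> norm_num
    rw [h0, zero_mul] at hwin
    have hθ' : θ ≤ 4 * Real.pi ^ 2 := by nlinarith
    exact gpw_of_le_one v hℓ (by omega) hm Ψ hB hθ'
  · obtain ⟨k, rfl⟩ : ∃ k, n = k + 2 := ⟨n - 2, by omega⟩
    refine gpw_sectorGap_of_groundState_le v hℓ hm Ψ hB ?_
    set I : ℝ := (∫⁻ x : Space, v ‖x‖).toReal with hIdef
    have hI0 : 0 ≤ I := ENNReal.toReal_nonneg
    have hIeq : (∫⁻ x : Space, v ‖x‖) = ENNReal.ofReal I := (ENNReal.ofReal_toReal hI).symm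
    set A : ℝ := (((k + 2).choose 2 : ℕ) : ℝ) with hAdef
    have hA0 : 0 ≤ A := Nat.cast_nonneg _
    have hE : periodicGroundStateEnergy v (k + 2) ℓ ≤ ENNReal.ofReal (A * ((ℓ ^ 3)⁻¹ * I)) := by
      refine (IMUChainGlue.periodicGroundStateEnergy_le_pairs hℓ hv k).trans (le_of_eq ?_)
      rw [hIeq, ← ENNReal.ofReal_pow hℓ.le, ← ENNReal.ofReal_inv_of_pos (by positivity),
        ← ENNReal.ofReal_mul (by positivity), ← ENNReal.ofReal_natCast,
        ← ENNReal.ofReal_mul (Nat.cast_nonneg _)]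
    -- the window in the form `A · I ≤ (4π² - θ) ℓ`
    have hA : A = ((k : ℝ) + 2) * ((k : ℝ) + 2 - 1) / 2 := by
      rw [hAdef, Nat.cast_choose_two]; push_cast; ring
    have hwin' : A * I ≤ (4 * Real.pi ^ 2 - θ) * ℓ := by
      rw [hA]
      push_cast at hwin
      nlinarith [hwin]
    have hreal : A * ((ℓ ^ 3)⁻¹ * I) + θ / ℓ ^ 2 ≤ (2 * Real.pi / ℓ) ^ 2 := by
      have hℓ2 : 0 < ℓ ^ 2 := by positivity
      have hstep : A * I / ℓ ≤ 4 * Real.pi ^ 2 - θ := by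
        rw [div_le_iff₀ hℓ]; exact hwin'
      calc A * ((ℓ ^ 3)⁻¹ * I) + θ / ℓ ^ 2 = (A * I / ℓ + θ) / ℓ ^ 2 := by
            field_simp
        _ ≤ ((4 * Real.pi ^ 2 - θ) + θ) / ℓ ^ 2 := by gcongr
        _ = (2 * Real.pi / ℓ) ^ 2 := by rw [div_pow]; ring
    calc periodicGroundStateEnergy v (k + 2) ℓ + ENNReal.ofReal (θ / ℓ ^ 2)
        ≤ ENNReal.ofReal (A * ((ℓ ^ 3)⁻¹ * I)) + ENNReal.ofReal (θ / ℓ ^ 2) := by gcongr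
      _ = ENNReal.ofReal (A * ((ℓ ^ 3)⁻¹ * I) + θ / ℓ ^ 2) :=
          (ENNReal.ofReal_add (by positivity) (by positivity)).symm
      _ ≤ ENNReal.ofReal ((2 * Real.pi / ℓ) ^ 2) := ENNReal.ofReal_le_ofReal hreal

end Summit.AtomisticToContinuum.BoseEinsteinCondensation.Theorems

end
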